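/-
Copyright (c) 2026. All rights reserved.
Released under Apache 2.0 license as described in the file LICENSE.
Authors: abc-iut cell, wave-2 seat abc-iut-L3-t11 (proof-only; G10 rung 4: Thm 3.7 (iv) from (i)(ii)(iii) — the
residual `EdgeLikeIsInfVerticial` of `TemperedMaximalCompact.lean` discharged).
-/
import Literature.AnabelianGeometry.SemiGraphs.TemperedEdgeLikeDistinctProofs
import HarnessLib

/-!
# [SemiAnbd] Thm 3.7 (iv) from (i), (ii), (iii): edge-like subgroups are intersections of two verticial ones

Mochizuki, *Semi-graphs of anabelioids*, Publ. RIMS **42** (2006) [MochizukiSemiAnbd2006], Thm 3.7 (iv) p. 41: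
"The maximal compact subgroups of `π₁^temp(G)` are precisely the verticial subgroups. The nontrivial
intersections of two distinct maximal compact subgroups of `π₁^temp(G)` are precisely the edge-like subgroups."

PROOF-ONLY (no definitions). `TemperedMaximalCompact.lean` (p407451) reduced (iv) to (ii), (iii) and the
residual named fact `EdgeLikeIsInfVerticial` (a nontrivial edge-like subgroup of a CLOSED edge is `H₁ ⊓ H₂` for
two distinct verticial subgroups). This file DISCHARGES that residual from Thm 3.7 (i) `VerticialInjective`,
(ii) `VerticialDistinct`, (iii) `CompactInVerticial` with the toolkit of `TemperedEdgeLikeDistinctProofs.lean`: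
`L = gφ_u(Π_b)g⁻¹ = g'φ_{u'}(Π_{b'})g'⁻¹` for the two branches of `e` lies in two hosts `H`, `H'`, distinct by
LEMMA E; the compact `H ⊓ H' ⊇ L` lies (by (iii)) in an edge-like `L''` whose host is `H` or `H'`, hence
`L''` is a conjugate of the image of the SAME `Π_b` inside the same host; commensurable terminality and
estrangement (`b' = b`, `g ∉ Π_b`) force `L'' = L`, so `L = H ⊓ H'`
(`edgeLikeIsInfVerticial_of`). Whence (iv): `maximalCompactIffVerticial_of_thm37`.
-/

namespace Literature.AnabelianGeometry.SemiGraphs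

namespace ProfiniteSemiGraph

open CategoryTheory Topology

universe u

variable {𝒢 : ProfiniteSemiGraph.{u}}

/-- **Rigidity of a branch image in its host**: if `L = gφ_u(Π_b)g⁻¹ ≠ 1` is contained in
`L'' = g''φ_{u''}(Π_{b''})g''⁻¹` and the two hosts `gφ_u(Π_u)g⁻¹`, `g''φ_{u''}(Π_{u''})g''⁻¹` coincide, then
`L'' = L` (`b'' = b` by `branch_eq_of_hosts_eq`; then `g⁻¹g'' ∈ φ_u(Π_u)` by commensurable terminality, and the
resulting `Π_b ≤ yΠ_by⁻¹` forces `y ∈ Π_b` by estrangement, `Π_b` being infinite).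
[cite: MochizukiSemiAnbd2006, Thm 3.7(iv) p.41] -/
theorem map_branch_eq_of_le_of_hosts_eq (hVD : VerticialDistinct.{u}) (hVI : VerticialInjective.{u})
    (h𝒢 : 𝒢.Thm37Hypotheses) (c : TemperedPiChart 𝒢) (Φ : ∀ v : 𝒢.graph.Vertex, 𝒢.Gv v →ₜ* c.G)
    (hΦ : ∀ v, IsVerticialHom c v (Φ v)) {u u'' : 𝒢.graph.Vertex} {b b'' : 𝒢.graph.Branch}
    (hb : 𝒢.graph.abuts b = some u) (hb'' : 𝒢.graph.abuts b'' = some u'') (g g'' : c.G)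
    (hne : ((𝒢.branchSubgroup b u hb).map (Φ u).toMonoidHom).map (MulAut.conj g).toMonoidHom ≠ ⊥)
    (hle : ((𝒢.branchSubgroup b u hb).map (Φ u).toMonoidHom).map (MulAut.conj g).toMonoidHom ≤
      ((𝒢.branchSubgroup b'' u'' hb'').map (Φ u'').toMonoidHom).map (MulAut.conj g'').toMonoidHom)
    (hH : (Φ u).toMonoidHom.range.map (MulAut.conj g).toMonoidHom =
      (Φ u'').toMonoidHom.range.map (MulAut.conj g'').toMonoidHom) :
    ((𝒢.branchSubgroup b'' u'' hb'').map (Φ u'').toMonoidHom).map (MulAut.conj g'').toMonoidHom =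
      ((𝒢.branchSubgroup b u hb).map (Φ u).toMonoidHom).map (MulAut.conj g).toMonoidHom := by
  -- `b'' = b`, hence `u'' = u`
  have hbb := branch_eq_of_hosts_eq hVD hVI h𝒢 c Φ hΦ hne hb hb'' g g'' le_rfl hle hH
  subst hbb
  have huu : u = u'' := Option.some.inj (hb.symm.trans hb'')
  subst huu
  -- commensurable terminality: `g⁻¹ g'' = Φ u y`
  have hmem : g⁻¹ * g'' ∈ (Φ u).toMonoidHom.range := by
    by_contra hn
    have h0 := (hVD 𝒢 h𝒢 c).2 u _ (range_mem_verticialSubgroups c (Φ u) (hΦ u)) g g'' hn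
    rw [← hH, Subgroup.relIndex_self] at h0
    exact one_ne_zero h0
  obtain ⟨y, hy⟩ := hmem
  have hg'' : g'' = g * (Φ u).toMonoidHom y := by rw [hy, mul_inv_cancel_left]
  have hnat : (MulAut.conj g'').toMonoidHom.comp (Φ u).toMonoidHom =
      ((MulAut.conj g).toMonoidHom.comp (Φ u).toMonoidHom).comp (MulAut.conj y).toMonoidHom := by
    ext x; simp [hg'', mul_assoc]
  set B := 𝒢.branchSubgroup b u hb with hBdef
  have h2 : (B.map (Φ u).toMonoidHom).map (MulAut.conj g'').toMonoidHom =
      ((B.map (MulAut.conj y).toMonoidHom).map (Φ u).toMonoidHom).map (MulAut.conj g).toMonoidHom := by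
    rw [Subgroup.map_map, hnat, ← Subgroup.map_map, ← Subgroup.map_map]
  rw [h2] at hle ⊢
  -- `Π_b ≤ y Π_b y⁻¹` inside `Π_u`
  have hinj : Function.Injective ((MulAut.conj g).toMonoidHom.comp (Φ u).toMonoidHom) :=
    (MulAut.conj g).injective.comp ((hVI 𝒢 h𝒢 c u).2 (Φ u) (hΦ u))
  have hle' : B ≤ B.map (MulAut.conj y).toMonoidHom := by
    rw [Subgroup.map_map, Subgroup.map_map] at hle
    exact (Subgroup.map_le_map_iff_of_injective hinj).mp hle
  -- `y ∈ Π_b`, for otherwise estrangement makes `Π_b` trivial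
  have hyB : y ∈ B := by
    by_contra hy
    have hest := (h𝒢.isTotallyEstranged (𝒢.graph.edgeOf b)).2 b rfl u hb b hb y (Or.inr hy)
    have hBbot : B = ⊥ := by
      rw [eq_bot_iff, ← hest]
      exact le_inf le_rfl hle'
    haveI := infinite_branchSubgroup h𝒢.toProp36Hypotheses hb
    rw [← hBdef] at this
    rw [hBbot] at this
    exact not_finite (⊥ : Subgroup (𝒢.Gv u))
  have hBy : B.map (MulAut.conj y).toMonoidHom = B := by
    ext x
    constructor
    · rintro ⟨z, hz, rfl⟩
      exact B.mul_mem (B.mul_mem hyB hz) (B.inv_mem hyB)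
    · intro hx
      exact ⟨y⁻¹ * x * y, B.mul_mem (B.mul_mem (B.inv_mem hyB) hx) hyB, by simp [mul_assoc]⟩
  rw [hBy]

/-- **The residual of G10 rung 4, DISCHARGED**: `EdgeLikeIsInfVerticial` — a nontrivial edge-like subgroup of
a closed edge is the intersection of two distinct verticial subgroups — from Thm 3.7 (i), (ii), (iii).
[cite: MochizukiSemiAnbd2006, Thm 3.7(iv) p.41] -/
theorem edgeLikeIsInfVerticial_of (hCV : CompactInVerticial.{u}) (hVD : VerticialDistinct.{u})
    (hVI : VerticialInjective.{u}) : EdgeLikeIsInfVerticial.{u} := by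
  intro 𝒢 h𝒢 c e he L hL hLne
  classical
  haveI := TemperedPiChart.t2Space c
  have hΦ' : ∀ v : 𝒢.graph.Vertex, ∃ φ : 𝒢.Gv v →ₜ* c.G, IsVerticialHom c v φ := by
    intro v
    obtain ⟨H, φ, hφ, -⟩ := (hVI 𝒢 h𝒢 c v).1
    exact ⟨φ, hφ⟩
  choose Φ hΦ using hΦ'
  -- the two branches of the closed edge and the two presentations of `L`
  obtain ⟨b, b', u, u', hbb', hbe, hb'e, hb, hb'⟩ := SemiGraph.exists_branches_of_isClosedEdge he
  subst hbe
  obtain ⟨g, hLeq⟩ := edgeLike_eq_map_branchSubgroup c hb hL (Φ u) (hΦ u)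
  have hLb' : L ∈ edgeLikeSubgroups c (𝒢.graph.edgeOf b') := by rw [hb'e]; exact hL
  obtain ⟨g', hLeq'⟩ := edgeLike_eq_map_branchSubgroup c hb' hLb' (Φ u') (hΦ u')
  set H := (Φ u).toMonoidHom.range.map (MulAut.conj g).toMonoidHom with hHdef
  set H' := (Φ u').toMonoidHom.range.map (MulAut.conj g').toMonoidHom with hH'def
  have hHm : H ∈ verticialSubgroups c u :=
    conj_mem_verticialSubgroups c (range_mem_verticialSubgroups c (Φ u) (hΦ u)) g
  have hH'm : H' ∈ verticialSubgroups c u' :=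
    conj_mem_verticialSubgroups c (range_mem_verticialSubgroups c (Φ u') (hΦ u')) g'
  have hLH : L ≤ H := by rw [hLeq]; exact Subgroup.map_mono (Subgroup.map_le_range _ _)
  have hLH' : L ≤ H' := by rw [hLeq']; exact Subgroup.map_mono (Subgroup.map_le_range _ _)
  -- the hosts are distinct (LEMMA E)
  have hHH' : H ≠ H' := by
    intro hHH'
    refine hbb' (branch_eq_of_hosts_eq hVD hVI h𝒢 c Φ hΦ hLne hb hb' g g' ?_ ?_ hHH')
    · rw [← hLeq]
    · rw [← hLeq']
  refine ⟨u, u', H, H', hHm, hH'm, hHH', le_antisymm (le_inf hLH hLH') ?_⟩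
  -- `K = H ⊓ H'` is compact, nontrivial, with hosts `H`, `H'`
  have hKc : IsCompact ((H ⊓ H' : Subgroup c.G) : Set c.G) := by
    rw [Subgroup.coe_inf]
    exact (isCompact_of_mem_verticialSubgroups c hHm).inter_right
      (isCompact_of_mem_verticialSubgroups c hH'm).isClosed
  have hKne : H ⊓ H' ≠ ⊥ := fun h => hLne (le_bot_iff.mp (h ▸ le_inf hLH hLH'))
  obtain ⟨honly, e'', L'', he'', hL'', hKL''⟩ :=
    (hCV 𝒢 h𝒢 c (H ⊓ H') hKc).2 hKne u u' H H' hHm hH'm hHH' inf_le_left inf_le_right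
  obtain ⟨b'', -, u'', -, -, hbe'', -, hb'', -⟩ := SemiGraph.exists_branches_of_isClosedEdge he''
  subst hbe''
  obtain ⟨g'', hLeq''⟩ := edgeLike_eq_map_branchSubgroup c hb'' hL'' (Φ u'') (hΦ u'')
  set H'' := (Φ u'').toMonoidHom.range.map (MulAut.conj g'').toMonoidHom with hH''def
  have hH''m : H'' ∈ verticialSubgroups c u'' :=
    conj_mem_verticialSubgroups c (range_mem_verticialSubgroups c (Φ u'') (hΦ u'')) g''
  have hKH'' : H ⊓ H' ≤ H'' :=
    hKL''.trans (by rw [hLeq'']; exact Subgroup.map_mono (Subgroup.map_le_range _ _))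
  have hLL'' : L ≤ L'' := (le_inf hLH hLH').trans hKL''
  -- the host of `L''` is `H` or `H'`; in either case `L'' = L`
  have hLne₁ : ((𝒢.branchSubgroup b u hb).map (Φ u).toMonoidHom).map (MulAut.conj g).toMonoidHom ≠ ⊥ := by
    rw [← hLeq]; exact hLne
  have hLne₂ : ((𝒢.branchSubgroup b' u' hb').map (Φ u').toMonoidHom).map (MulAut.conj g').toMonoidHom ≠ ⊥ := by
    rw [← hLeq']; exact hLne
  rcases honly u'' H'' hH''m hKH'' with h1 | h2
  · have := map_branch_eq_of_le_of_hosts_eq hVD hVI h𝒢 c Φ hΦ hb hb'' g g'' hLne₁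
      (by rw [← hLeq, ← hLeq'']; exact hLL'') h1.symm
    rw [← hLeq'', ← hLeq] at this
    rw [← this]; exact hKL''
  · have := map_branch_eq_of_le_of_hosts_eq hVD hVI h𝒢 c Φ hΦ hb' hb'' g' g'' hLne₂
      (by rw [← hLeq', ← hLeq'']; exact hLL'') h2.symm
    rw [← hLeq'', ← hLeq'] at this
    rw [← this]; exact hKL''

/-- **[SemiAnbd] Thm 3.7 (iv) from (i), (ii), (iii)** (G10 rung 4 closed modulo rungs 1–3): maximal compact ⇔
verticial, and the nontrivial intersections of two distinct maximal compact subgroups are exactly the edge-like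
subgroups of closed edges. [cite: MochizukiSemiAnbd2006, Thm 3.7(iv) p.41] -/
theorem maximalCompactIffVerticial_of_thm37 (hCV : CompactInVerticial.{u}) (hVD : VerticialDistinct.{u})
    (hVI : VerticialInjective.{u}) : MaximalCompactIffVerticial.{u} :=
  MaximalCompactIffVerticial_of hCV hVD (edgeLikeIsInfVerticial_of hCV hVD hVI)

end ProfiniteSemiGraph

end Literature.AnabelianGeometry.SemiGraphs
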